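import Summits.HodgeConjecture.CorCM.Census.CoinvariantComplement

/-!
# The coinvariant fibre `φ₂(G, c)`, XIII: the DIRECT-FACTOR COINVARIANT THEOREM — `φ₂ = β − 1 − δ` whenever `c` is complemented

COR-CM (cell `pub-hodgecm2`), count-neutral kernel combinatorics by the binder seat b09 (gen 31; lane DIRECT-FACTOR), part XIII,
sequel of `Census/CoinvariantComplement.lean` (XII).  Theorems + ONE bookkeeping definition with body (`rho`, a linear retraction of
`𝔽₂[types]` onto a complement of the Hodge lattice mod `2`); no `decide` beyond closed identities in `ZMod 2`, no certificate, no named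
fact, no `sorry`.  HONEST FRAMING: `HC_CM` is NOT proved, here or anywhere in the tree; nothing here is a period or a headline.

THE THEOREM (`fibreTwo_add_one_add_wdelta_eq_card_block_of_cpl`).  Let `c` be a central involution of the finite group `G` with a
COMPLEMENT `A` (`x ∈ A ↔ c·x ∉ A`, i.e. `G = A × ⟨c⟩`, ANY finite `A`).  Then **`φ₂(G, c) + 1 + δ(G, c) = β(G, c)`**: the coinvariant
floor of part II IS the parity floor of gen 28 — the deficit `φ₂ − (β − 1 − δ)` (André-3ʼs «divided parities», gen 30ʼs `t`)
vanishes on every direct-factor CM type.  Split by the parity of `|A| = |G|/2`: `|A|` even ⇒ `δ = 1` (transfer criterion: `g^{|A|} = 1`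
for all `g`) and **`φ₂ + 2 = β`** (`fibreTwo_add_two_eq_card_block_of_cpl`); `|A|` odd is part X (`φ₂ + 1 = β`, `δ = 0`).  This is gen
29ʼs DIRECT-FACTOR conjecture (COINVARIANT-FLOOR.md §«Recommended next»; numerically every deficit row of order `≤ 32` — `Q₈`, `Q₁₆`,
`SD₁₆`, `M₁₆`, `ℤ/4×ℤ/2 (c ∈ 2G)`, `ℤ₃×Q₈`, `ℤ₄×S₃`, … — has `⟨c⟩` non-complemented; re-checked for `A ∈ {ℤ/2, …, ℤ/8, ℤ/4×ℤ/2, ℤ/2³,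
S₃, D₄, Q₈}`: e.g. `β(S₃×ℤ/2) = 10, φ₂ = 8`; `β(D₄×ℤ/2) = 27, φ₂ = 25`; `β(Q₈×ℤ/2) = 21, φ₂ = 19`).

PROOF (elementary form of the surjectivity `H₁(A; 𝔽₂[types]/pairs) ↠ H₁(A; 𝔽₂[A]/N ⊕ 𝔽₂)`).  With `T = A` the complement type
(XII) and `t = ts2 v`:
* §1 the linear **retraction** `ρ(v) = (t(1)+t(c))·[T] + Σ_{d ∈ A} (t(d)+t(1))·([T^{(d)}] + [T])` has `ts2 (ρ v)` explicit
  (`ts2_rho`), whence `v − ρ(v) ∈ hodge2` (`sub_rho_mem_hodge2`: its type sum is the constant `t(c)`) and `ρ(hodge2) = 0`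
  (`rho_eq_zero_of_mem_hodge2`);
* §2 **the commutator with base change is a multiple of `Σ₁`**: `(ρ v)·a⁻¹ − ρ(v·a⁻¹) = (t(1) + t(a))·Σ₁` for `a ∈ A`, `|A|` even
  (`mapDomain_rt_rho_sub_rho_mapDomain_rt`) — the only non-equivariance of `ρ` is the cocycle generating `H¹(A; I_A) ≅ 𝔽₂`, and it
  lands on `Σ₁ ∈ rad2` (XII `sigma1_cplT_mem_rad2`);
* §3 hence `y − ρ(y) ∈ rad2` for every `y` in the augmentation submodule `𝔽₂⟨z·Q⁻¹ − z⟩` (`sub_rho_mem_rad2_of_mem_span`; a `Q ∉ A`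
  is `c·a` with `a ∈ A`, and `c`-coboundaries are pairs, part VII `mapDomain_rt_self_sub_mem_pair2`), so by part V §3
  (`ker par2 =` augmentation submodule) **`hodge2 ∩ ker par2 ≤ rad2`** (`mem_rad2_of_par2_eq_zero_of_cpl`);
* §4 `φ₂ ≤ dim par2(hodge2) = β − 1 − δ` (gen 28 exact rank) meets part IIʼs domination `β ≤ φ₂ + 1 + δ`.

## References
* [Pohlmann1968] H. Pohlmann, Algebraic cycles on abelian varieties of complex multiplication type, Ann. of Math. 88 (1968), Thm 1.
-/

namespace Summit.HodgeConjecture.CorCM.Census.Coinvariant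

open Finset
open Summit.HodgeConjecture.CorCM.Prior.AllgGroup.RfwfAllgGroup
open Summit.HodgeConjecture.CorCM.Census.BlockParity

noncomputable section

variable {G : Type*} [Group G] [Fintype G] [DecidableEq G] (c : G)

/-! ## §1 The retraction `ρ` onto a complement of the Hodge lattice mod `2` -/

/-- **The retraction** `ρ(v) = (t(1)+t(c))·[A] + Σ_{d ∈ A} (t(d)+t(1))·([A^{(d)}] + [A])`, `t = ts2 v`: a linear endomorphism of
`𝔽₂[types]` vanishing on `hodge2` with `v − ρ(v) ∈ hodge2` (a projection onto a complement of the Hodge lattice mod `2`, chosen with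
base point `1 ∈ A`). [folklore] -/
def rho (hc2 : c * c = 1) {A : Subgroup G} (hA : ∀ x : G, x ∈ A ↔ c * x ∉ A) :
    (CMF G c →₀ ZMod 2) →ₗ[ZMod 2] (CMF G c →₀ ZMod 2) :=
  ((LinearMap.proj (R := ZMod 2) (φ := fun _ : G => ZMod 2) 1 + LinearMap.proj (R := ZMod 2) (φ := fun _ : G => ZMod 2) c).smulRight
      (Finsupp.single (cplT c A hA) 1) +
    ∑ d ∈ (cplT c A hA).1,
      (LinearMap.proj (R := ZMod 2) (φ := fun _ : G => ZMod 2) d + LinearMap.proj (R := ZMod 2) (φ := fun _ : G => ZMod 2) 1).smulRight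
        (Finsupp.single (oflipCM c hc2 d (cplT c A hA)) 1 + Finsupp.single (cplT c A hA) 1)) ∘ₗ ts2 c

/-- The formula for `ρ`. [folklore] -/
theorem rho_apply (hc2 : c * c = 1) {A : Subgroup G} (hA : ∀ x : G, x ∈ A ↔ c * x ∉ A) (v : CMF G c →₀ ZMod 2) :
    rho c hc2 hA v = (ts2 c v 1 + ts2 c v c) • Finsupp.single (cplT c A hA) 1 +
      ∑ d ∈ (cplT c A hA).1, (ts2 c v d + ts2 c v 1) •
        (Finsupp.single (oflipCM c hc2 d (cplT c A hA)) 1 + Finsupp.single (cplT c A hA) 1) := by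
  simp only [rho, LinearMap.coe_comp, Function.comp_apply, LinearMap.add_apply, LinearMap.smulRight_apply,
    LinearMap.proj_apply, LinearMap.sum_apply]

/-- **The type sum of `ρ(v)`**: `(t(1)+t(c))·[x ∈ A] + (t(x) + t(1))` for `x ∈ A`, `+ (t(cx) + t(1))` for `x ∉ A`. [folklore] -/
theorem ts2_rho (hc2 : c * c = 1) (hc1 : c ≠ 1) {A : Subgroup G} (hA : ∀ x : G, x ∈ A ↔ c * x ∉ A) (v : CMF G c →₀ ZMod 2)
    (x : G) :
    ts2 c (rho c hc2 hA v) x = (ts2 c v 1 + ts2 c v c) * (if x ∈ (cplT c A hA).1 then 1 else 0) +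
      (if x ∈ (cplT c A hA).1 then ts2 c v x + ts2 c v 1 else ts2 c v (c * x) + ts2 c v 1) := by
  have key : ∀ d, ts2 c (Finsupp.single (oflipCM c hc2 d (cplT c A hA)) 1 + Finsupp.single (cplT c A hA) 1) x =
      if x ∈ orb c d then 1 else 0 := fun d => by
    rw [map_add, Pi.add_apply, ts2_single_oflipCM, add_comm (ts2 c _ x) _, add_assoc, CharTwo.add_self_eq_zero, add_zero]
  rw [rho_apply, map_add, map_smul, map_sum, Pi.add_apply, Pi.smul_apply, Finset.sum_apply, smul_eq_mul, ts2_single]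
  simp_rw [map_smul, Pi.smul_apply, smul_eq_mul, key]
  rw [sum_mul_ite_mem_orb c hc2 hc1 (cplT c A hA) (fun d => ts2 c v d + ts2 c v 1) x]

/-- A closed identity in `𝔽₂` (the type sum of `v − ρ v` inside the complement). [folklore] -/
theorem zmod2_sub_rho_inside (p q r : ZMod 2) : r - ((p + q) * 1 + (r + p)) = q := by
  revert p q r; decide

/-- A closed identity in `𝔽₂` (the type sum of `v − ρ v` outside the complement). [folklore] -/
theorem zmod2_sub_rho_outside (p q r s : ZMod 2) (h : r + s = p + q) : r - ((p + q) * 0 + (s + p)) = q := by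
  revert p q r s; decide

/-- **`v − ρ(v)` is a Hodge vector mod `2`** (its type sum is the constant `t(c)`). [folklore] -/
theorem sub_rho_mem_hodge2 (hc2 : c * c = 1) (hc1 : c ≠ 1) (hcen : ∀ x : G, x * c = c * x) {A : Subgroup G}
    (hA : ∀ x : G, x ∈ A ↔ c * x ∉ A) (v : CMF G c →₀ ZMod 2) : v - rho c hc2 hA v ∈ hodge2 c hc2 := by
  refine mem_hodge2_of_forall_ts2_eq c hc2 hc1 hcen (a := ts2 c v c) fun x => ?_
  rw [map_sub, Pi.sub_apply, ts2_rho c hc2 hc1 hA]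
  by_cases hx : x ∈ (cplT c A hA).1
  · rw [if_pos hx, if_pos hx]
    exact zmod2_sub_rho_inside _ _ _
  · rw [if_neg hx, if_neg hx]
    exact zmod2_sub_rho_outside _ _ _ _ (ts2_add_ts2_cmul_eq c v x)

/-- **`ρ` vanishes on the Hodge lattice mod `2`.** [folklore] -/
theorem rho_eq_zero_of_mem_hodge2 (hc2 : c * c = 1) (hcen : ∀ x : G, x * c = c * x) {A : Subgroup G}
    (hA : ∀ x : G, x ∈ A ↔ c * x ∉ A) {v : CMF G c →₀ ZMod 2} (hv : v ∈ hodge2 c hc2) : rho c hc2 hA v = 0 := by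
  obtain ⟨a, ha⟩ := exists_forall_ts2_eq_of_mem_hodge2 c hc2 hcen hv
  rw [rho_apply]
  simp only [ha, CharTwo.add_self_eq_zero, zero_smul, Finset.sum_const_zero, add_zero]

/-! ## §2 The commutator of `ρ` with base change along the complement -/

/-- `ρ` of a base change along `a ∈ A`, re-indexed over `A·a`. [folklore] -/
theorem rho_mapDomain_rt (hc2 : c * c = 1) {A : Subgroup G} (hA : ∀ x : G, x ∈ A ↔ c * x ∉ A) {a : G} (ha : a ∈ A)
    (v : CMF G c →₀ ZMod 2) :
    rho c hc2 hA (Finsupp.mapDomain (rt c a) v) = (ts2 c v 1 + ts2 c v c) • Finsupp.single (cplT c A hA) 1 +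
      ∑ d ∈ (cplT c A hA).1, (ts2 c v d + ts2 c v a) •
        (Finsupp.single (oflipCM c hc2 (d * a⁻¹) (cplT c A hA)) 1 + Finsupp.single (cplT c A hA) 1) := by
  rw [rho_apply]
  simp_rw [ts2_mapDomain_rt, one_mul]
  rw [ts2_add_ts2_cmul_eq]
  congr 1
  refine Finset.sum_equiv (Equiv.mulRight a) (fun d => ?_) (fun d _ => ?_)
  · rw [mem_cplT, mem_cplT, Equiv.coe_mulRight]
    exact (Subgroup.mul_mem_cancel_right A ha).symm
  · rw [Equiv.coe_mulRight, mul_inv_cancel_right]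

/-- Base change along `a ∈ A` of `ρ(v)`. [folklore] -/
theorem mapDomain_rt_rho (hc2 : c * c = 1) {A : Subgroup G} (hA : ∀ x : G, x ∈ A ↔ c * x ∉ A) {a : G} (ha : a ∈ A)
    (v : CMF G c →₀ ZMod 2) :
    Finsupp.mapDomain (rt c a) (rho c hc2 hA v) = (ts2 c v 1 + ts2 c v c) • Finsupp.single (cplT c A hA) 1 +
      ∑ d ∈ (cplT c A hA).1, (ts2 c v d + ts2 c v 1) •
        (Finsupp.single (oflipCM c hc2 (d * a⁻¹) (cplT c A hA)) 1 + Finsupp.single (cplT c A hA) 1) := by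
  rw [rho_apply, Finsupp.mapDomain_add, Finsupp.mapDomain_smul, Finsupp.mapDomain_finsetSum, mapDomain_rt_single_cplT c hA ha]
  simp_rw [Finsupp.mapDomain_smul, Finsupp.mapDomain_add, Finsupp.mapDomain_single, rt_oflipCM_cplT c hc2 hA ha, rt_cplT c hA ha]

/-- In an `𝔽₂[types]`, an even multiple vanishes. [folklore] -/
theorem nsmul_eq_zero_of_even {n : ℕ} (hn : Even n) (w : CMF G c →₀ ZMod 2) : n • w = 0 := by
  rw [← Nat.cast_smul_eq_nsmul (ZMod 2), (ZMod.natCast_eq_zero_iff_even).mpr hn, zero_smul]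

/-- **THE COMMUTATOR FORMULA** (`|A|` even): `(ρ v)·a⁻¹ − ρ(v·a⁻¹) = (t(1) + t(a))·Σ₁` for `a ∈ A`. [folklore] -/
theorem mapDomain_rt_rho_sub_rho_mapDomain_rt (hc2 : c * c = 1) {A : Subgroup G} (hA : ∀ x : G, x ∈ A ↔ c * x ∉ A)
    (heven : Even (Fintype.card G / 2)) {a : G} (ha : a ∈ A) (v : CMF G c →₀ ZMod 2) :
    Finsupp.mapDomain (rt c a) (rho c hc2 hA v) - rho c hc2 hA (Finsupp.mapDomain (rt c a) v) =
      (ts2 c v 1 + ts2 c v a) • sigma1 c hc2 (cplT c A hA) := by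
  rw [mapDomain_rt_rho c hc2 hA ha, rho_mapDomain_rt c hc2 hA ha, add_sub_add_left_eq_sub, ← Finset.sum_sub_distrib]
  simp_rw [← sub_smul, add_sub_add_left_eq_sub]
  rw [← Finset.smul_sum, Finset.sum_add_distrib, sum_single_oflipCM_mul_inv c hc2 hA ha, Finset.sum_const, card_cplT c hc2 hA,
    nsmul_eq_zero_of_even c heven, add_zero, sub_eq_add_neg, ZMod.neg_eq_self_mod_two]

/-! ## §3 `hodge2 ∩ ker par2 ≤ rad2` for complemented `c` -/

/-- A coboundary along `a ∈ A`, corrected by `ρ`, lies in `rad2` (`|A|` even). [folklore] -/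
theorem mapDomain_rt_sub_sub_rho_mem_rad2 (hc2 : c * c = 1) (hc1 : c ≠ 1) (hcen : ∀ x : G, x * c = c * x) {A : Subgroup G}
    (hA : ∀ x : G, x ∈ A ↔ c * x ∉ A) (heven : Even (Fintype.card G / 2)) {a : G} (ha : a ∈ A) (z : CMF G c →₀ ZMod 2) :
    (Finsupp.mapDomain (rt c a) z - z) - rho c hc2 hA (Finsupp.mapDomain (rt c a) z - z) ∈ rad2 c hc2 := by
  have e : (Finsupp.mapDomain (rt c a) z - z) - rho c hc2 hA (Finsupp.mapDomain (rt c a) z - z) =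
      (Finsupp.mapDomain (rt c a) (z - rho c hc2 hA z) - (z - rho c hc2 hA z)) +
        (Finsupp.mapDomain (rt c a) (rho c hc2 hA z) - rho c hc2 hA (Finsupp.mapDomain (rt c a) z)) := by
    rw [map_sub, Finsupp.mapDomain_sub]; abel
  rw [e, mapDomain_rt_rho_sub_rho_mapDomain_rt c hc2 hA heven ha]
  exact Submodule.add_mem _ (mapDomain_rt_sub_mem_rad2 c hc2 hcen a (sub_rho_mem_hodge2 c hc2 hc1 hcen hA z))
    (Submodule.smul_mem _ _ (sigma1_cplT_mem_rad2 c hc2 hc1 hcen hA heven))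

/-- **`y − ρ(y) ∈ rad2` on the whole augmentation submodule** `𝔽₂⟨z·Q⁻¹ − z⟩` (`|A|` even). [folklore] -/
theorem sub_rho_mem_rad2_of_mem_span (hc2 : c * c = 1) (hc1 : c ≠ 1) (hcen : ∀ x : G, x * c = c * x) {A : Subgroup G}
    (hA : ∀ x : G, x ∈ A ↔ c * x ∉ A) (heven : Even (Fintype.card G / 2)) {y : CMF G c →₀ ZMod 2}
    (hy : y ∈ Submodule.span (ZMod 2)
      {y : CMF G c →₀ ZMod 2 | ∃ (Q : G) (z : CMF G c →₀ ZMod 2), y = Finsupp.mapDomain (rt c Q) z - z}) :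
    y - rho c hc2 hA y ∈ rad2 c hc2 := by
  induction hy using Submodule.span_induction with
  | mem y hy =>
    obtain ⟨Q, z, rfl⟩ := hy
    by_cases hQ : Q ∈ A
    · exact mapDomain_rt_sub_sub_rho_mem_rad2 c hc2 hc1 hcen hA heven hQ z
    · -- `Q = c·a` with `a = cQ ∈ A`: split off the `c`-coboundary, a sum of pairs
      have hcQ : c * Q ∈ A := cmul_mem_cpl c hA hQ
      set w := Finsupp.mapDomain (rt c (c * Q)) z with hw
      have hsplit : Finsupp.mapDomain (rt c Q) z = Finsupp.mapDomain (rt c c) w := by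
        rw [hw, ← mapDomain_rt_mul, ← mul_assoc, hc2, one_mul]
      have hp : Finsupp.mapDomain (rt c c) w - w ∈ pair2 c := mapDomain_rt_self_sub_mem_pair2 c w
      have e : Finsupp.mapDomain (rt c Q) z - z - rho c hc2 hA (Finsupp.mapDomain (rt c Q) z - z) =
          (Finsupp.mapDomain (rt c c) w - w) - rho c hc2 hA (Finsupp.mapDomain (rt c c) w - w) +
            ((w - z) - rho c hc2 hA (w - z)) := by
        rw [hsplit, map_sub, map_sub, map_sub]; abel
      rw [e, rho_eq_zero_of_mem_hodge2 c hc2 hcen hA (Submodule.mem_sup_right hp : _ ∈ hodge2 c hc2), sub_zero]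
      exact Submodule.add_mem _ (pair2_le_rad2 c hc2 hp) (mapDomain_rt_sub_sub_rho_mem_rad2 c hc2 hc1 hcen hA heven hcQ z)
  | zero => rw [map_zero, sub_zero]; exact Submodule.zero_mem _
  | add y y' _ _ hy hy' =>
    have e : y + y' - rho c hc2 hA (y + y') = (y - rho c hc2 hA y) + (y' - rho c hc2 hA y') := by rw [map_add]; abel
    rw [e]; exact Submodule.add_mem _ hy hy'
  | smul r y _ hy =>
    have e : r • y - rho c hc2 hA (r • y) = r • (y - rho c hc2 hA y) := by rw [map_smul, smul_sub]
    rw [e]; exact Submodule.smul_mem _ _ hy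

/-- **KEY (complemented `c`, `|A|` even)**: a Hodge vector mod `2` with zero block sums lies in `rad2 = pairs + coboundaries`.
[folklore] -/
theorem mem_rad2_of_par2_eq_zero_of_cpl (hc2 : c * c = 1) (hc1 : c ≠ 1) (hcen : ∀ x : G, x * c = c * x) {A : Subgroup G}
    (hA : ∀ x : G, x ∈ A ↔ c * x ∉ A) (heven : Even (Fintype.card G / 2)) {x : CMF G c →₀ ZMod 2} (hx : x ∈ hodge2 c hc2)
    (hpx : par2 c x = 0) : x ∈ rad2 c hc2 := by
  have h := sub_rho_mem_rad2_of_mem_span c hc2 hc1 hcen hA heven (mem_span_cobdryAll_of_par2_eq_zero c hpx)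
  rwa [rho_eq_zero_of_mem_hodge2 c hc2 hcen hA hx, sub_zero] at h

/-- **`hodge2 ⊓ ker par2 ≤ rad2`** for complemented `c` (either parity of `|A|`; the odd case is part X). [folklore] -/
theorem inf_ker_par2_le_rad2_of_cpl (hc2 : c * c = 1) (hc1 : c ≠ 1) (hcen : ∀ x : G, x * c = c * x) {A : Subgroup G}
    (hA : ∀ x : G, x ∈ A ↔ c * x ∉ A) : hodge2 c hc2 ⊓ LinearMap.ker (par2 c) ≤ rad2 c hc2 := fun x hx => by
  rcases Nat.even_or_odd (Fintype.card G / 2) with heven | hodd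
  · exact mem_rad2_of_par2_eq_zero_of_cpl c hc2 hc1 hcen hA heven hx.1 (LinearMap.mem_ker.mp hx.2)
  · exact mem_rad2_of_par2_eq_zero_of_odd_half c hc2 hc1 hcen hodd hx.1 (LinearMap.mem_ker.mp hx.2)

/-! ## §4 The direct-factor coinvariant theorem -/

omit [Fintype G] [DecidableEq G] in
/-- **A subgroup of index two missing `c` is a complement of `c`.** [folklore] -/
theorem cpl_of_index_two {A : Subgroup G} (h2 : A.index = 2) (hc : c ∉ A) (x : G) : x ∈ A ↔ c * x ∉ A := by
  rw [Subgroup.mul_mem_iff_of_index_two h2]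
  tauto

omit [Fintype G] [DecidableEq G] in
/-- Conversely, for central `c` a complement has index two. [folklore] -/
theorem index_eq_two_of_cpl (hcen : ∀ x : G, x * c = c * x) {A : Subgroup G} (hA : ∀ x : G, x ∈ A ↔ c * x ∉ A) :
    A.index = 2 := by
  refine Subgroup.index_eq_two_iff.mpr ⟨c, fun b => ?_⟩
  rw [hcen b]
  have h := hA b
  tauto


/-- **`φ₂ ≤ dim par2(hodge2)`** for complemented `c`. [folklore] -/
theorem fibreTwo_le_finrank_span_par_of_cpl (hc2 : c * c = 1) (hc1 : c ≠ 1) (hcen : ∀ x : G, x * c = c * x) {A : Subgroup G}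
    (hA : ∀ x : G, x ∈ A ↔ c * x ∉ A) :
    fibreTwo c hc2 ≤ Module.finrank (ZMod 2) ↥(Submodule.span (ZMod 2) (par c '' gfaceSet G c hc2)) := by
  rw [span_par_gfaceSet_eq_map, ← map_par2_hodge2]
  have h1 := LinearMap.finrank_range_add_finrank_ker (V := ↥(hodge2 c hc2)) ((par2 c).domRestrict (hodge2 c hc2))
  rw [LinearMap.range_domRestrict, LinearMap.ker_domRestrict] at h1
  have h2 : Submodule.comap (hodge2 c hc2).subtype (LinearMap.ker (par2 c)) ≤
      Submodule.comap (hodge2 c hc2).subtype (rad2 c hc2) := fun v hv =>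
    inf_ker_par2_le_rad2_of_cpl c hc2 hc1 hcen hA ⟨v.2, hv⟩
  have h3 := Submodule.finrank_mono h2
  rw [(Submodule.comapSubtypeEquivOfLe (rad2_le_hodge2 c hc2)).finrank_eq] at h3
  have h4 := finrank_rad2_add_fibreTwo c hc2
  omega

/-- **The two floors coincide for complemented `c`**: `φ₂ = dim_𝔽₂ span par(faces)` (`= β − 1 − δ`). [folklore] -/
theorem fibreTwo_eq_finrank_span_par_of_cpl (hc2 : c * c = 1) (hc1 : c ≠ 1) (hcen : ∀ x : G, x * c = c * x) {A : Subgroup G}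
    (hA : ∀ x : G, x ∈ A ↔ c * x ∉ A) :
    fibreTwo c hc2 = Module.finrank (ZMod 2) ↥(Submodule.span (ZMod 2) (par c '' gfaceSet G c hc2)) :=
  le_antisymm (fibreTwo_le_finrank_span_par_of_cpl c hc2 hc1 hcen hA) (finrank_span_par_le_fibreTwo c hc2)

/-- **THE DIRECT-FACTOR COINVARIANT THEOREM: `φ₂(G, c) + 1 + δ(G, c) = β(G, c)` whenever `c` has a complement** (`G = A × ⟨c⟩`, any
finite `A`; `δ` read at any base type). [folklore] -/
theorem fibreTwo_add_one_add_wdelta_eq_card_block_of_cpl (hc2 : c * c = 1) (hc1 : c ≠ 1) (hcen : ∀ x : G, x * c = c * x)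
    {A : Subgroup G} (hA : ∀ x : G, x ∈ A ↔ c * x ∉ A) (T₀ : CMF G c) :
    fibreTwo c hc2 + 1 + wdelta c T₀ = Fintype.card (Block c) := by
  have h1 := finrank_span_par_gfaceSet_add c hc2 T₀
  rw [← fibreTwo_eq_finrank_span_par_of_cpl c hc2 hc1 hcen hA] at h1
  exact h1

/-- **`|A|` even ⇒ every `g ∈ G = A × ⟨c⟩` has `g^{|G|/2} = 1`** (so `δ = 1` by gen 28ʼs transfer criterion). [folklore] -/
theorem pow_half_card_eq_one_of_cpl (hc2 : c * c = 1) (hcen : ∀ x : G, x * c = c * x) {A : Subgroup G}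
    (hA : ∀ x : G, x ∈ A ↔ c * x ∉ A) (heven : Even (Fintype.card G / 2)) (g : G) : g ^ (Fintype.card G / 2) = 1 := by
  have hA' : ∀ a ∈ A, a ^ (Fintype.card G / 2) = 1 := fun a ha =>
    orderOf_dvd_iff_pow_eq_one.mp ((Subgroup.orderOf_dvd_natCard A ha).trans (by rw [natCard_cpl c hc2 hA]))
  have hc : c ^ (Fintype.card G / 2) = 1 := by
    obtain ⟨k, hk⟩ := heven
    rw [hk, ← two_mul, pow_mul, pow_two, hc2, one_pow]
  by_cases hg : g ∈ A
  · exact hA' g hg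
  · have hcg : c * g ∈ A := cmul_mem_cpl c hA hg
    have e : g = c * (c * g) := (cmul_cmul c hc2 g).symm
    have hcomm : Commute c (c * g) := by
      change c * (c * g) = c * g * c
      rw [hcen (c * g)]
    rw [e, hcomm.mul_pow, hc, one_mul, hA' _ hcg]

/-- **`|A|` even ⇒ `δ = 1`.** [folklore] -/
theorem wdelta_eq_one_of_cpl (hc2 : c * c = 1) (hc1 : c ≠ 1) (hcen : ∀ x : G, x * c = c * x) {A : Subgroup G}
    (hA : ∀ x : G, x ∈ A ↔ c * x ∉ A) (heven : Even (Fintype.card G / 2)) (T₀ : CMF G c) : wdelta c T₀ = 1 :=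
  (wdelta_eq_one_iff c hc2 hc1 hcen T₀).mpr (pow_half_card_eq_one_of_cpl c hc2 hcen hA heven)

/-- **`|A|` EVEN: `φ₂(G, c) + 2 = β(G, c)`** for `G = A × ⟨c⟩` — e.g. `S₃ × ℤ/2: 8 + 2 = 10`, `D₄ × ℤ/2: 25 + 2 = 27`, `Q₈ × ℤ/2: 19 + 2 = 21`,
`(ℤ/2)⁴: 28 + 2 = 30`; the split-cyclic part VIII is the case `A` cyclic of even order; for `|A|` odd, part X
(`fibreTwo_add_one_eq_card_block_of_odd_half`) gives `φ₂ + 1 = β`. [folklore] -/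
theorem fibreTwo_add_two_eq_card_block_of_cpl (hc2 : c * c = 1) (hc1 : c ≠ 1) (hcen : ∀ x : G, x * c = c * x)
    {A : Subgroup G} (hA : ∀ x : G, x ∈ A ↔ c * x ∉ A) (heven : Even (Fintype.card G / 2)) :
    fibreTwo c hc2 + 2 = Fintype.card (Block c) := by
  have h := fibreTwo_add_one_add_wdelta_eq_card_block_of_cpl c hc2 hc1 hcen hA (cplT c A hA)
  rw [wdelta_eq_one_of_cpl c hc2 hc1 hcen hA heven] at h
  omega

end

end Summit.HodgeConjecture.CorCM.Census.Coinvariant
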